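import Mathlib
import HarnessLib
import Summits.HubbardSuperconductivity.HubbardSuperconductivity.Theorems.KLProgrammeC4aJacobianPolarJetsFour

/-!
# Route `KLProgramme` — crux C4a, named input (i) «Jacobian jets», ORDER 4, part 2: `|J⁗|` for the polar Jacobian `J = u / ∂_t e` (abstract setting)

Cell `gate-hubbard-kl`, lane hubbard-kl-c4a-1 (g2); helper for stub (C) of `KLRegimeEngineV17F2` (stmt-HubbardSuperconductivity-20437; memo
HOME/hubbard-kl-c4a-1/C4A-PLAN.md §13).  Completes order 4 of the 1-D polar pattern of `…C4aJacobianPolarJets` (0–2), `…Three` (3), `…Four` (`|D⁗| ≤ Δ₄`):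
for a `C⁵` function `e` on `Fin 2 → ℝ`, a `C⁴` radius `u`, the radial slope `D ϑ = De(u ϑ•dir ϑ)[dir ϑ] ≥ ρ₀ > 0` and sizes `E₁…E₅`, `U₀`, `R₁…R₄`,
`|J⁗| ≤ R₄/ρ₀ + 4R₃Δ₁/ρ₀² + 6R₂Δ₂/ρ₀² + 12R₂Δ₁²/ρ₀³ + 4R₁Δ₃/ρ₀² + 24R₁Δ₁Δ₂/ρ₀³ + 24R₁Δ₁³/ρ₀⁴ + U₀Δ₄/ρ₀² + 8U₀Δ₁Δ₃/ρ₀³ + 6U₀Δ₂²/ρ₀³ + 36U₀Δ₁²Δ₂/ρ₀⁴ + 24U₀Δ₁⁴/ρ₀⁵`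
(Leibniz for `J = u·w`, `w = 1/D`: `w⁗ = −D₄/D² + (8D₁D₃+6D₂²)/D³ − 36D₁²D₂/D⁴ + 24D₁⁴/D⁵`), graded and affine in `E₅`.  The `D‴` function and the
differentiability of it are re-derived from the same `clm_apply`/`add` tree as part 1 (generator HOME/hubbard-kl-c4a-1/gen/gen_order4jac.py).
Pure calculus; nothing about the Hubbard model.  References: BGM 2006 §2.4 Lemma 2.1 (2.40) [cite: BenfattoGiulianiMastropietro2006].
-/

noncomputable section

namespace Summit.HubbardSuperconductivity.HubbardSuperconductivity.Theorems.C4a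

set_option linter.dupNamespace false -- summit = problem name (single-conjunct summit), D-0017
set_option maxSynthPendingDepth 5 -- nested operator-norm instances (fifth Fréchet derivatives)

open Real Set
open Literature.MathematicalPhysics.QuantumLattice Literature.MathematicalPhysics.QuantumLattice.BandSectorCounting
open Summit.HubbardSuperconductivity.HubbardSuperconductivity.Theorems.PerturbedFermiCurve

/-- The twelve-term algebraic bound behind `abs_deriv_four_polarJac_le` (`J⁗` for `J = u/D` in terms of `|u⁽ⁱ⁾| ≤ Rᵢ`, `|D⁽ⁱ⁾| ≤ Δᵢ`, `|D| ≥ ρ₀`). -/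
theorem abs_polarJac_four_terms_le {ρ₀ D D₁ D₂ D₃ D₄ u0 u1 u2 u3 u4 U₀ R₁ R₂ R₃ R₄ Δ1 Δ2 Δ3 Δ4 : ℝ} (hρ0 : 0 < ρ₀)
    (hDabs : ρ₀ ≤ |D|) (hU₀ : |u0| ≤ U₀) (hR₁ : |u1| ≤ R₁) (hR₂ : |u2| ≤ R₂) (hR₃ : |u3| ≤ R₃) (hR₄ : |u4| ≤ R₄)
    (hΔ₁ : |D₁| ≤ Δ1) (hΔ₂ : |D₂| ≤ Δ2) (hΔ₃ : |D₃| ≤ Δ3) (hΔ₄ : |D₄| ≤ Δ4) :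
    |u4 / D - 4 * (u3 * D₁) / D ^ 2 - 6 * (u2 * D₂) / D ^ 2 + 12 * (u2 * D₁ ^ 2) / D ^ 3 - 4 * (u1 * D₃) / D ^ 2 + 24 * (u1 * (D₁ * D₂)) / D ^ 3 - 24 * (u1 * D₁ ^ 3) / D ^ 4 - u0 * D₄ / D ^ 2 + 8 * (u0 * (D₁ * D₃)) / D ^ 3 + 6 * (u0 * D₂ ^ 2) / D ^ 3 - 36 * (u0 * (D₁ ^ 2 * D₂)) / D ^ 4 + 24 * (u0 * D₁ ^ 4) / D ^ 5| ≤
      R₄ / ρ₀ + 4 * (R₃ * Δ1) / ρ₀ ^ 2 + 6 * (R₂ * Δ2) / ρ₀ ^ 2 + 12 * (R₂ * Δ1 ^ 2) / ρ₀ ^ 3 + 4 * (R₁ * Δ3) / ρ₀ ^ 2 + 24 * (R₁ * (Δ1 * Δ2)) / ρ₀ ^ 3 + 24 * (R₁ * Δ1 ^ 3) / ρ₀ ^ 4 + U₀ * Δ4 / ρ₀ ^ 2 + 8 * (U₀ * (Δ1 * Δ3)) / ρ₀ ^ 3 + 6 * (U₀ * Δ2 ^ 2) / ρ₀ ^ 3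 + 36 * (U₀ * (Δ1 ^ 2 * Δ2)) / ρ₀ ^ 4 + 24 * (U₀ * Δ1 ^ 4) / ρ₀ ^ 5 := by
  have hU0 : 0 ≤ U₀ := (abs_nonneg _).trans hU₀; have hR10 : 0 ≤ R₁ := (abs_nonneg _).trans hR₁
  have hR20 : 0 ≤ R₂ := (abs_nonneg _).trans hR₂; have hR30 : 0 ≤ R₃ := (abs_nonneg _).trans hR₃
  have hΔ10 : 0 ≤ Δ1 := (abs_nonneg _).trans hΔ₁; have hΔ20 : 0 ≤ Δ2 := (abs_nonneg _).trans hΔ₂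
  have hΔ30 : 0 ≤ Δ3 := (abs_nonneg _).trans hΔ₃; have hΔ40 : 0 ≤ Δ4 := (abs_nonneg _).trans hΔ₄
  have hp2 : ρ₀ ^ 2 ≤ |D| ^ 2 := pow_le_pow_left₀ hρ0.le hDabs 2
  have hp3 : ρ₀ ^ 3 ≤ |D| ^ 3 := pow_le_pow_left₀ hρ0.le hDabs 3
  have hp4 : ρ₀ ^ 4 ≤ |D| ^ 4 := pow_le_pow_left₀ hρ0.le hDabs 4
  have hp5 : ρ₀ ^ 5 ≤ |D| ^ 5 := pow_le_pow_left₀ hρ0.le hDabs 5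
  have hsq : |D₁| ^ 2 ≤ Δ1 ^ 2 := pow_le_pow_left₀ (abs_nonneg _) hΔ₁ 2
  have hcb : |D₁| ^ 3 ≤ Δ1 ^ 3 := pow_le_pow_left₀ (abs_nonneg _) hΔ₁ 3
  have hqr : |D₁| ^ 4 ≤ Δ1 ^ 4 := pow_le_pow_left₀ (abs_nonneg _) hΔ₁ 4
  have hsq2 : |D₂| ^ 2 ≤ Δ2 ^ 2 := pow_le_pow_left₀ (abs_nonneg _) hΔ₂ 2
  -- twelve terms
  have t1 : |u4 / D| ≤ R₄ / ρ₀ := by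
    rw [abs_div]; exact div_le_div₀ ((abs_nonneg _).trans hR₄) hR₄ hρ0 hDabs
  have t2 : |4 * (u3 * D₁) / D ^ 2| ≤ 4 * (R₃ * Δ1) / ρ₀ ^ 2 := by
    rw [abs_div, abs_mul, abs_mul, abs_pow, show |(4 : ℝ)| = 4 by norm_num]
    exact div_le_div₀ (by positivity) (mul_le_mul_of_nonneg_left (mul_le_mul hR₃ hΔ₁ (abs_nonneg _) hR30) (by norm_num))
      (pow_pos hρ0 2) hp2
  have t3 : |6 * (u2 * D₂) / D ^ 2| ≤ 6 * (R₂ * Δ2) / ρ₀ ^ 2 := by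
    rw [abs_div, abs_mul, abs_mul, abs_pow, show |(6 : ℝ)| = 6 by norm_num]
    exact div_le_div₀ (by positivity) (mul_le_mul_of_nonneg_left (mul_le_mul hR₂ hΔ₂ (abs_nonneg _) hR20) (by norm_num))
      (pow_pos hρ0 2) hp2
  have t4 : |12 * (u2 * D₁ ^ 2) / D ^ 3| ≤ 12 * (R₂ * Δ1 ^ 2) / ρ₀ ^ 3 := by
    rw [abs_div, abs_mul, abs_mul, abs_pow, abs_pow, show |(12 : ℝ)| = 12 by norm_num]
    exact div_le_div₀ (by positivity) (mul_le_mul_of_nonneg_left (mul_le_mul hR₂ hsq (by positivity) hR20) (by norm_num))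
      (pow_pos hρ0 3) hp3
  have t5 : |4 * (u1 * D₃) / D ^ 2| ≤ 4 * (R₁ * Δ3) / ρ₀ ^ 2 := by
    rw [abs_div, abs_mul, abs_mul, abs_pow, show |(4 : ℝ)| = 4 by norm_num]
    exact div_le_div₀ (by positivity) (mul_le_mul_of_nonneg_left (mul_le_mul hR₁ hΔ₃ (abs_nonneg _) hR10) (by norm_num))
      (pow_pos hρ0 2) hp2
  have t6 : |24 * (u1 * (D₁ * D₂)) / D ^ 3| ≤ 24 * (R₁ * (Δ1 * Δ2)) / ρ₀ ^ 3 := by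
    rw [abs_div, abs_mul, abs_mul, abs_mul, abs_pow, show |(24 : ℝ)| = 24 by norm_num]
    exact div_le_div₀ (by positivity)
      (mul_le_mul_of_nonneg_left (mul_le_mul hR₁ (mul_le_mul hΔ₁ hΔ₂ (abs_nonneg _) hΔ10)
        (mul_nonneg (abs_nonneg _) (abs_nonneg _)) hR10) (by norm_num)) (pow_pos hρ0 3) hp3
  have t7 : |24 * (u1 * D₁ ^ 3) / D ^ 4| ≤ 24 * (R₁ * Δ1 ^ 3) / ρ₀ ^ 4 := by
    rw [abs_div, abs_mul, abs_mul, abs_pow, abs_pow, show |(24 : ℝ)| = 24 by norm_num]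
    exact div_le_div₀ (by positivity) (mul_le_mul_of_nonneg_left (mul_le_mul hR₁ hcb (by positivity) hR10) (by norm_num))
      (pow_pos hρ0 4) hp4
  have t8 : |u0 * D₄ / D ^ 2| ≤ U₀ * Δ4 / ρ₀ ^ 2 := by
    rw [abs_div, abs_mul, abs_pow]
    exact div_le_div₀ (mul_nonneg hU0 hΔ40) (mul_le_mul hU₀ hΔ₄ (abs_nonneg _) hU0) (pow_pos hρ0 2) hp2
  have t9 : |8 * (u0 * (D₁ * D₃)) / D ^ 3| ≤ 8 * (U₀ * (Δ1 * Δ3)) / ρ₀ ^ 3 := by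
    rw [abs_div, abs_mul, abs_mul, abs_mul, abs_pow, show |(8 : ℝ)| = 8 by norm_num]
    exact div_le_div₀ (by positivity)
      (mul_le_mul_of_nonneg_left (mul_le_mul hU₀ (mul_le_mul hΔ₁ hΔ₃ (abs_nonneg _) hΔ10)
        (mul_nonneg (abs_nonneg _) (abs_nonneg _)) hU0) (by norm_num)) (pow_pos hρ0 3) hp3
  have t10 : |6 * (u0 * D₂ ^ 2) / D ^ 3| ≤ 6 * (U₀ * Δ2 ^ 2) / ρ₀ ^ 3 := by
    rw [abs_div, abs_mul, abs_mul, abs_pow, abs_pow, show |(6 : ℝ)| = 6 by norm_num]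
    exact div_le_div₀ (by positivity) (mul_le_mul_of_nonneg_left (mul_le_mul hU₀ hsq2 (by positivity) hU0) (by norm_num))
      (pow_pos hρ0 3) hp3
  have t11 : |36 * (u0 * (D₁ ^ 2 * D₂)) / D ^ 4| ≤ 36 * (U₀ * (Δ1 ^ 2 * Δ2)) / ρ₀ ^ 4 := by
    rw [abs_div, abs_mul, abs_mul, abs_mul, abs_pow, abs_pow, show |(36 : ℝ)| = 36 by norm_num]
    exact div_le_div₀ (by positivity)
      (mul_le_mul_of_nonneg_left (mul_le_mul hU₀ (mul_le_mul hsq hΔ₂ (abs_nonneg _) (by positivity))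
        (mul_nonneg (by positivity) (abs_nonneg _)) hU0) (by norm_num)) (pow_pos hρ0 4) hp4
  have t12 : |24 * (u0 * D₁ ^ 4) / D ^ 5| ≤ 24 * (U₀ * Δ1 ^ 4) / ρ₀ ^ 5 := by
    rw [abs_div, abs_mul, abs_mul, abs_pow, abs_pow, show |(24 : ℝ)| = 24 by norm_num]
    exact div_le_div₀ (by positivity) (mul_le_mul_of_nonneg_left (mul_le_mul hU₀ hqr (by positivity) hU0) (by norm_num))
      (pow_pos hρ0 5) hp5
  calc |u4 / D - 4 * (u3 * D₁) / D ^ 2 - 6 * (u2 * D₂) / D ^ 2 + 12 * (u2 * D₁ ^ 2) / D ^ 3 - 4 * (u1 * D₃) / D ^ 2 + 24 * (u1 * (D₁ * D₂)) / D ^ 3 - 24 * (u1 * D₁ ^ 3) / D ^ 4 - u0 * D₄ / D ^ 2 + 8 * (u0 * (D₁ * D₃)) / D ^ 3 + 6 * (u0 * D₂ ^ 2) / D ^ 3 - 36 * (u0 * (D₁ ^ 2 * D₂)) / D ^ 4 + 24 * (u0 * D₁ ^ 4) / D ^ 5|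
      ≤ |u4 / D| + |4 * (u3 * D₁) / D ^ 2| + |6 * (u2 * D₂) / D ^ 2| + |12 * (u2 * D₁ ^ 2) / D ^ 3| + |4 * (u1 * D₃) / D ^ 2| + |24 * (u1 * (D₁ * D₂)) / D ^ 3| + |24 * (u1 * D₁ ^ 3) / D ^ 4| + |u0 * D₄ / D ^ 2| + |8 * (u0 * (D₁ * D₃)) / D ^ 3| + |6 * (u0 * D₂ ^ 2) / D ^ 3| + |36 * (u0 * (D₁ ^ 2 * D₂)) / D ^ 4| + |24 * (u0 * D₁ ^ 4) / D ^ 5| := by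
        refine (abs_add_le _ _).trans (add_le_add ?_ le_rfl)
        refine (abs_sub _ _).trans (add_le_add ?_ le_rfl)
        refine (abs_add_le _ _).trans (add_le_add ?_ le_rfl)
        refine (abs_add_le _ _).trans (add_le_add ?_ le_rfl)
        refine (abs_sub _ _).trans (add_le_add ?_ le_rfl)
        refine (abs_sub _ _).trans (add_le_add ?_ le_rfl)
        refine (abs_add_le _ _).trans (add_le_add ?_ le_rfl)
        refine (abs_sub _ _).trans (add_le_add ?_ le_rfl)
        refine (abs_add_le _ _).trans (add_le_add ?_ le_rfl)
        refine (abs_sub _ _).trans (add_le_add ?_ le_rfl)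
        exact abs_sub _ _
    _ ≤ _ := (add_le_add (add_le_add (add_le_add (add_le_add (add_le_add (add_le_add (add_le_add (add_le_add (add_le_add (add_le_add (add_le_add t1 t2) t3) t4) t5) t6) t7) t8) t9) t10) t11) t12)

section Polar

variable {e : (Fin 2 → ℝ) → ℝ} (he : ContDiff ℝ 5 e) {u : ℝ → ℝ} (hu : ContDiff ℝ 4 u)
include he hu

set_option maxHeartbeats 800000 in -- three quotient-rule normal forms (`field_simp; ring`) of growing size
/-- **Order 4**: `|J⁗| ≤ R₄/ρ₀ + 4R₃Δ₁/ρ₀² + 6R₂Δ₂/ρ₀² + 12R₂Δ₁²/ρ₀³ + 4R₁Δ₃/ρ₀² + 24R₁Δ₁Δ₂/ρ₀³ + 24R₁Δ₁³/ρ₀⁴ + U₀Δ₄/ρ₀² + 8U₀Δ₁Δ₃/ρ₀³ +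
6U₀Δ₂²/ρ₀³ + 36U₀Δ₁²Δ₂/ρ₀⁴ + 24U₀Δ₁⁴/ρ₀⁵` for `J = u/D`, with `Δ₁ = E₂K₁ + E₁`, `Δ₂ = E₃K₁² + E₂K₂ + 2E₂K₁ + E₁`,
`Δ₃ = E₄K₁³ + 3E₃K₁K₂ + 3E₃K₁² + E₂K₃ + 3E₂K₂ + 3E₂K₁ + E₁` and `Δ₄` the polynomial of `abs_radialSlope_deriv_four_le`
(`K₁ = R₁+U₀`, `K₂ = R₂+2R₁+U₀`, `K₃ = R₃+3R₂+3R₁+U₀`, `K₄ = R₄+6R₂+U₀+(4R₃+4R₁)`) — graded, affine in `E₅`. -/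
theorem abs_deriv_four_polarJac_le {ρ₀ E₁ E₂ E₃ E₄ E₅ U₀ R₁ R₂ R₃ R₄ : ℝ} (hρ0 : 0 < ρ₀)
    (hρ : ∀ ϑ, ρ₀ ≤ fderiv ℝ e (u ϑ • dir ϑ) (dir ϑ))
    (hE₁ : ∀ ϑ, ‖fderiv ℝ e (u ϑ • dir ϑ)‖ ≤ E₁) (hE₂ : ∀ ϑ, ‖fderiv ℝ (fderiv ℝ e) (u ϑ • dir ϑ)‖ ≤ E₂)
    (hE₃ : ∀ ϑ, ‖fderiv ℝ (fderiv ℝ (fderiv ℝ e)) (u ϑ • dir ϑ)‖ ≤ E₃)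
    (hE₄ : ∀ ϑ, ‖fderiv ℝ (fderiv ℝ (fderiv ℝ (fderiv ℝ e))) (u ϑ • dir ϑ)‖ ≤ E₄)
    (hE₅ : ∀ ϑ, ‖fderiv ℝ (fderiv ℝ (fderiv ℝ (fderiv ℝ (fderiv ℝ e)))) (u ϑ • dir ϑ)‖ ≤ E₅)
    (hU₀ : ∀ ϑ, |u ϑ| ≤ U₀) (hR₁ : ∀ ϑ, |deriv u ϑ| ≤ R₁) (hR₂ : ∀ ϑ, |deriv (deriv u) ϑ| ≤ R₂)
    (hR₃ : ∀ ϑ, |deriv (deriv (deriv u)) ϑ| ≤ R₃) (hR₄ : ∀ ϑ, |deriv (deriv (deriv (deriv u))) ϑ| ≤ R₄) (ϑ : ℝ) :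
    |deriv (deriv (deriv (deriv (fun t : ℝ => u t / fderiv ℝ e (u t • dir t) (dir t))))) ϑ| ≤
      R₄ / ρ₀ + 4 * (R₃ * (E₂ * (R₁ + U₀) + E₁)) / ρ₀ ^ 2 + 6 * (R₂ * (E₃ * (R₁ + U₀) ^ 2 + E₂ * (R₂ + 2 * R₁ + U₀) + 2 * (E₂ * (R₁ + U₀)) + E₁)) / ρ₀ ^ 2 + 12 * (R₂ * (E₂ * (R₁ + U₀) + E₁) ^ 2) / ρ₀ ^ 3 +
        4 * (R₁ * (E₄ * (R₁ + U₀) ^ 3 + 3 * (E₃ * (R₁ + U₀) * (R₂ + 2 * R₁ + U₀)) + 3 * (E₃ * (R₁ + U₀) ^ 2) + E₂ * (R₃ + 3 * R₂ + 3 * R₁ + U₀) + 3 * (E₂ * (R₂ + 2 * R₁ + U₀)) + 3 * (E₂ * (R₁ + U₀)) + E₁)) / ρ₀ ^ 2 +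
        24 * (R₁ * ((E₂ * (R₁ + U₀) + E₁) * (E₃ * (R₁ + U₀) ^ 2 + E₂ * (R₂ + 2 * R₁ + U₀) + 2 * (E₂ * (R₁ + U₀)) + E₁))) / ρ₀ ^ 3 + 24 * (R₁ * (E₂ * (R₁ + U₀) + E₁) ^ 3) / ρ₀ ^ 4 +
        U₀ * (E₁ + 4 * E₂ * (R₁ + U₀) + 6 * E₂ * (R₂ + 2 * R₁ + U₀) + 4 * E₂ * (R₃ + 3 * R₂ + 3 * R₁ + U₀) + E₂ * (R₄ + 6 * R₂ + U₀ + (4 * R₃ + 4 * R₁)) + 6 * E₃ * (R₁ + U₀) * (R₁ + U₀) + 12 * E₃ * (R₁ + U₀) * (R₂ + 2 * R₁ + U₀) + 4 * E₃ * (R₁ + U₀) * (R₃ + 3 * R₂ + 3 * R₁ + U₀) + 3 * E₃ * (R₂ + 2 * R₁ + U₀) * (R₂ + 2 * R₁ + U₀) + 4 * E₄ * (R₁ + U₀) * (R₁ + U₀) * (R₁ + U₀) + 6 * E₄ * (R₁ + U₀) * (R₁ + U₀) * (R₂ + 2 * R₁ + U₀) + E₅ * (R₁ + U₀) * (R₁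 + U₀) * (R₁ + U₀) * (R₁ + U₀)) / ρ₀ ^ 2 +
        8 * (U₀ * ((E₂ * (R₁ + U₀) + E₁) * (E₄ * (R₁ + U₀) ^ 3 + 3 * (E₃ * (R₁ + U₀) * (R₂ + 2 * R₁ + U₀)) + 3 * (E₃ * (R₁ + U₀) ^ 2) + E₂ * (R₃ + 3 * R₂ + 3 * R₁ + U₀) + 3 * (E₂ * (R₂ + 2 * R₁ + U₀)) + 3 * (E₂ * (R₁ + U₀)) + E₁))) / ρ₀ ^ 3 +
        6 * (U₀ * (E₃ * (R₁ + U₀) ^ 2 + E₂ * (R₂ + 2 * R₁ + U₀) + 2 * (E₂ * (R₁ + U₀)) + E₁) ^ 2) / ρ₀ ^ 3 + 36 * (U₀ * ((E₂ * (R₁ + U₀) + E₁) ^ 2 * (E₃ * (R₁ + U₀) ^ 2 + E₂ * (R₂ + 2 * R₁ + U₀) + 2 * (E₂ * (R₁ + U₀)) + E₁))) / ρ₀ ^ 4 + 24 * (U₀ * (E₂ * (R₁ + U₀) + E₁) ^ 4) / ρ₀ ^ 5 := by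
  have he4 : ContDiff ℝ 4 e := he.of_le (by norm_num)
  -- the radial-slope functions `D, D′, D″, D‴` and their derivatives
  set Df : ℝ → ℝ := fun t => fderiv ℝ e (u t • dir t) (dir t) with hDf
  set D1f : ℝ → ℝ := fun t => fderiv ℝ (fderiv ℝ e) (u t • dir t) (deriv u t • dir t + u t • dir (t + π / 2)) (dir t) +
    fderiv ℝ e (u t • dir t) (dir (t + π / 2)) with hD1f
  set D2f : ℝ → ℝ := fun t =>
    (fderiv ℝ (fderiv ℝ (fderiv ℝ e)) (u t • dir t) (deriv u t • dir t + u t • dir (t + π / 2))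
          (deriv u t • dir t + u t • dir (t + π / 2)) +
        fderiv ℝ (fderiv ℝ e) (u t • dir t) ((deriv (deriv u) t - u t) • dir t + (2 * deriv u t) • dir (t + π / 2))) (dir t) +
      fderiv ℝ (fderiv ℝ e) (u t • dir t) (deriv u t • dir t + u t • dir (t + π / 2)) (dir (t + π / 2)) +
      (fderiv ℝ (fderiv ℝ e) (u t • dir t) (deriv u t • dir t + u t • dir (t + π / 2)) (dir (t + π / 2)) +
        fderiv ℝ e (u t • dir t) (-dir t)) with hD2f
  set D3f : ℝ → ℝ := fun t => ((((((((((fderiv ℝ (fderiv ℝ (fderiv ℝ (fderiv ℝ e))) (u t • dir t)) ((deriv u t • dir t + u t • dir (t + π / 2)))) ((deriv u t • dir t + u t • dir (t + π / 2)))) + ((fderiv ℝ (fderiv ℝ (fderiv ℝ e)) (u t • dir t)) (((deriv (deriv u) t - u t) • dir t + (2 * deriv u t) • dir (t + π / 2))))) ((deriv u t • dir t + u t • dir (t + π / 2)))) + (((fderiv ℝ (fderiv ℝ (fderiv ℝ e)) (u t • dir t)) ((deriv u t • dir t + u t • dir (t + π / 2)))) (((deriv (deriv u) t - u t) • dir t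 + (2 * deriv u t) • dir (t + π / 2))))) + ((((fderiv ℝ (fderiv ℝ (fderiv ℝ e)) (u t • dir t)) ((deriv u t • dir t + u t • dir (t + π / 2)))) (((deriv (deriv u) t - u t) • dir t + (2 * deriv u t) • dir (t + π / 2)))) + ((fderiv ℝ (fderiv ℝ e) (u t • dir t)) (((deriv (deriv (deriv u)) t - 3 * deriv u t) • dir t + (3 * deriv (deriv u) t - u t) • dir (t + π / 2)))))) (dir t)) + (((((fderiv ℝ (fderiv ℝ (fderiv ℝ e)) (u t • dir t)) ((deriv u t • dir t + u t • dir (t + π / 2)))) ((deriv u t • dir t + u t • dir (t + π / 2)))) + ((fderiv ℝ (fderiv ℝ e) (u t • dir t)) (((deriv (deriv u) t - u t) • dir t + (2 * deriv u t) • dir (t + π / 2))))) (dir (t + π / 2)))) + ((((((fderiv ℝ (fderiv ℝ (fderiv ℝ e)) (u t • dir t)) ((deriv u t • dir t + u t • dir (t + π / 2)))) ((deriv u t • dir t + u t • dir (t + π / 2)))) + ((fderiv ℝ (fderiv ℝ e) (u t • dir t)) (((deriv (deriv u) t - u t) • dir t + (2 * deriv u t) • dir (t + π / 2))))) (dir (t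 + π / 2))) + (((fderiv ℝ (fderiv ℝ e) (u t • dir t)) ((deriv u t • dir t + u t • dir (t + π / 2)))) (-dir t)))) + (((((((fderiv ℝ (fderiv ℝ (fderiv ℝ e)) (u t • dir t)) ((deriv u t • dir t + u t • dir (t + π / 2)))) ((deriv u t • dir t + u t • dir (t + π / 2)))) + ((fderiv ℝ (fderiv ℝ e) (u t • dir t)) (((deriv (deriv u) t - u t) • dir t + (2 * deriv u t) • dir (t + π / 2))))) (dir (t + π / 2))) + (((fderiv ℝ (fderiv ℝ e) (u t • dir t)) ((deriv u t • dir t + u t • dir (t + π / 2)))) (-dir t))) + ((((fderiv ℝ (fderiv ℝ e) (u t • dir t)) ((deriv u t • dir t + u t • dir (t + π / 2)))) (-dir t)) + ((fderiv ℝ e (u t • dir t)) (-dir (t + π / 2))))) with hD3f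
  have hDne : ∀ t, Df t ≠ 0 := fun t => (hρ0.trans_le (hρ t)).ne'
  have hD0 : ∀ t, HasDerivAt Df (D1f t) t := fun t => hasDerivAt_radialSlope he4 hu t
  have hD1 : ∀ t, HasDerivAt D1f (D2f t) t := fun t => hasDerivAt_radialSlope_deriv he4 hu t
  have hD2 : ∀ t, HasDerivAt D2f (D3f t) t := fun t => hasDerivAt_radialSlope_deriv_two he4 hu t
  -- differentiability of `D‴` at `ϑ` (same combinator tree as part 1)
  have h1 : ContDiff ℝ 4 (fderiv ℝ e) := he.fderiv_right (by norm_num)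
  have h2 : ContDiff ℝ 3 (fderiv ℝ (fderiv ℝ e)) := h1.fderiv_right (by norm_num)
  have h3 : ContDiff ℝ 2 (fderiv ℝ (fderiv ℝ (fderiv ℝ e))) := h2.fderiv_right (by norm_num)
  have h4 : ContDiff ℝ 1 (fderiv ℝ (fderiv ℝ (fderiv ℝ (fderiv ℝ e)))) := h3.fderiv_right (by norm_num)
  have hc1 : HasDerivAt (fun t : ℝ => fderiv ℝ e (u t • dir t)) ((fderiv ℝ (fderiv ℝ e) (u ϑ • dir ϑ)) (deriv u ϑ • dir ϑ + u ϑ • dir (ϑ + π / 2))) ϑ :=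
    ((h1.differentiable (by norm_num)) _).hasFDerivAt.comp_hasDerivAt ϑ (hasDerivAt_polar_zero hu ϑ)
  have hc2 : HasDerivAt (fun t : ℝ => fderiv ℝ (fderiv ℝ e) (u t • dir t)) ((fderiv ℝ (fderiv ℝ (fderiv ℝ e)) (u ϑ • dir ϑ)) (deriv u ϑ • dir ϑ + u ϑ • dir (ϑ + π / 2))) ϑ :=
    ((h2.differentiable (by norm_num)) _).hasFDerivAt.comp_hasDerivAt ϑ (hasDerivAt_polar_zero hu ϑ)
  have hc3 : HasDerivAt (fun t : ℝ => fderiv ℝ (fderiv ℝ (fderiv ℝ e)) (u t • dir t)) ((fderiv ℝ (fderiv ℝ (fderiv ℝ (fderiv ℝ e))) (u ϑ • dir ϑ)) (deriv u ϑ • dir ϑ + u ϑ • dir (ϑ + π / 2))) ϑ :=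
    ((h3.differentiable (by norm_num)) _).hasFDerivAt.comp_hasDerivAt ϑ (hasDerivAt_polar_zero hu ϑ)
  have hc4 : HasDerivAt (fun t : ℝ => fderiv ℝ (fderiv ℝ (fderiv ℝ (fderiv ℝ e))) (u t • dir t)) ((fderiv ℝ (fderiv ℝ (fderiv ℝ (fderiv ℝ (fderiv ℝ e)))) (u ϑ • dir ϑ)) (deriv u ϑ • dir ϑ + u ϑ • dir (ϑ + π / 2))) ϑ :=
    ((h4.differentiable (by norm_num)) _).hasFDerivAt.comp_hasDerivAt ϑ (hasDerivAt_polar_zero hu ϑ)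
  have hv1 := hasDerivAt_polar_one hu ϑ
  have hv2 := hasDerivAt_polar_two hu ϑ
  have hv3 := hasDerivAt_polar_three hu ϑ
  have hd := PerturbedFermiCurve.hasDerivAt_dir ϑ
  have hdp := hasDerivAt_dir_add_pi_div_two ϑ
  have hdn : HasDerivAt (fun t : ℝ => -dir t) (-dir (ϑ + π / 2)) ϑ := hd.neg
  have hdpn : HasDerivAt (fun t : ℝ => -dir (t + π / 2)) (-(-dir ϑ)) ϑ := hdp.neg
  have hD4 : HasDerivAt (fun t : ℝ => ((((((((((fderiv ℝ (fderiv ℝ (fderiv ℝ (fderiv ℝ e))) (u t • dir t)) ((deriv u t • dir t + u t • dir (t + π / 2)))) ((deriv u t • dir t + u t • dir (t + π / 2)))) + ((fderiv ℝ (fderiv ℝ (fderiv ℝ e)) (u t • dir t)) (((deriv (deriv u) t - u t) • dir t + (2 * deriv u t) • dir (t + π / 2))))) ((deriv u t • dir t + u t • dir (t + π / 2)))) + (((fderiv ℝ (fderiv ℝ (fderiv ℝ e)) (u t • dir t)) ((deriv u t • dir t + u t • dir (t + π / 2)))) (((deriv (deriv u) t - u t) • dir t + (2 * deriv u t) • dir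 (t + π / 2))))) + ((((fderiv ℝ (fderiv ℝ (fderiv ℝ e)) (u t • dir t)) ((deriv u t • dir t + u t • dir (t + π / 2)))) (((deriv (deriv u) t - u t) • dir t + (2 * deriv u t) • dir (t + π / 2)))) + ((fderiv ℝ (fderiv ℝ e) (u t • dir t)) (((deriv (deriv (deriv u)) t - 3 * deriv u t) • dir t + (3 * deriv (deriv u) t - u t) • dir (t + π / 2)))))) (dir t)) + (((((fderiv ℝ (fderiv ℝ (fderiv ℝ e)) (u t • dir t)) ((deriv u t • dir t + u t • dir (t + π / 2)))) ((deriv u t • dir t + u t • dir (t + π / 2)))) + ((fderiv ℝ (fderiv ℝ e) (u t • dir t)) (((deriv (deriv u) t - u t) • dir t + (2 * deriv u t) • dir (t + π / 2))))) (dir (t + π / 2)))) + ((((((fderiv ℝ (fderiv ℝ (fderiv ℝ e)) (u t • dir t)) ((deriv u t • dir t + u t • dir (t + π / 2)))) ((deriv u t • dir t + u t • dir (t + π / 2)))) + ((fderiv ℝ (fderiv ℝ e) (u t • dir t)) (((deriv (deriv u) t - u t) • dir t + (2 * deriv u t) • dir (t + π / 2))))) (dir (t + π / 2))) + (((fderiv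 ℝ (fderiv ℝ e) (u t • dir t)) ((deriv u t • dir t + u t • dir (t + π / 2)))) (-dir t)))) + (((((((fderiv ℝ (fderiv ℝ (fderiv ℝ e)) (u t • dir t)) ((deriv u t • dir t + u t • dir (t + π / 2)))) ((deriv u t • dir t + u t • dir (t + π / 2)))) + ((fderiv ℝ (fderiv ℝ e) (u t • dir t)) (((deriv (deriv u) t - u t) • dir t + (2 * deriv u t) • dir (t + π / 2))))) (dir (t + π / 2))) + (((fderiv ℝ (fderiv ℝ e) (u t • dir t)) ((deriv u t • dir t + u t • dir (t + π / 2)))) (-dir t))) + ((((fderiv ℝ (fderiv ℝ e) (u t • dir t)) ((deriv u t • dir t + u t • dir (t + π / 2)))) (-dir t)) + ((fderiv ℝ e (u t • dir t)) (-dir (t + π / 2)))))) _ ϑ := ((((((((((((((((((((hc4).clm_apply (hv1))).clm_apply (hv1))).add (((hc3).clm_apply (hv2))))).clm_apply (hv1))).add (((((hc3).clm_apply (hv1))).clm_apply (hv2))))).add (((((((hc3).clm_apply (hv1))).clm_apply (hv2))).add (((hc2).clm_apply (hv3))))))).clm_apply (hd))).add (((((((((hc3).clm_apply (hv1))).clm_apply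 (hv1))).add (((hc2).clm_apply (hv2))))).clm_apply (hdp))))).add (((((((((((hc3).clm_apply (hv1))).clm_apply (hv1))).add (((hc2).clm_apply (hv2))))).clm_apply (hdp))).add (((((hc2).clm_apply (hv1))).clm_apply (hdn))))))).add (((((((((((((hc3).clm_apply (hv1))).clm_apply (hv1))).add (((hc2).clm_apply (hv2))))).clm_apply (hdp))).add (((((hc2).clm_apply (hv1))).clm_apply (hdn))))).add (((((((hc2).clm_apply (hv1))).clm_apply (hdn))).add (((hc1).clm_apply (hdpn))))))))
  set D₄ : ℝ := deriv D3f ϑ with hD4def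
  have hD3 : HasDerivAt D3f D₄ ϑ := by rw [hD4def]; exact hD4.differentiableAt.hasDerivAt
  -- first and second derivatives of `J` as functions (as in order 3)
  have j1 : deriv (fun t : ℝ => u t / Df t) = fun t => (deriv u t * Df t - u t * D1f t) / Df t ^ 2 :=
    funext fun t => ((hasDerivAt_tower_of_contDiff_four hu t).1.fun_div (hD0 t) (hDne t)).deriv
  have j2 : deriv (fun t => (deriv u t * Df t - u t * D1f t) / Df t ^ 2) = fun t =>
      deriv (deriv u) t / Df t - u t * D2f t / Df t ^ 2 - 2 * (deriv u t * D1f t) / Df t ^ 2 +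
        2 * (u t * D1f t ^ 2) / Df t ^ 3 := by
    funext t
    obtain ⟨h0, h1, -, -⟩ := hasDerivAt_tower_of_contDiff_four hu t
    have hnum := (h1.fun_mul (hD0 t)).fun_sub (h0.fun_mul (hD1 t))
    have hden : HasDerivAt (fun s : ℝ => Df s ^ 2) (2 * Df t * D1f t) t := by
      have h := (hD0 t).fun_mul (hD0 t)
      have hfun : (fun s : ℝ => Df s ^ 2) = fun s => Df s * Df s := funext fun s => sq _
      rw [hfun]; exact h.congr_deriv (by ring)
    have hq : HasDerivAt (fun s : ℝ => (deriv u s * Df s - u s * D1f s) / Df s ^ 2)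
        ((((deriv (deriv u) t * Df t + deriv u t * D1f t) - (deriv u t * D1f t + u t * D2f t)) * Df t ^ 2 -
          (deriv u t * Df t - u t * D1f t) * (2 * Df t * D1f t)) / (Df t ^ 2) ^ 2) t :=
      hnum.fun_div hden (pow_ne_zero 2 (hDne t))
    rw [hq.deriv]
    have hD := hDne t
    field_simp
    ring
  -- third derivative as a function, in the seven-term split form of order 3
  have j3 : deriv (fun t => deriv (deriv u) t / Df t - u t * D2f t / Df t ^ 2 - 2 * (deriv u t * D1f t) / Df t ^ 2 +
        2 * (u t * D1f t ^ 2) / Df t ^ 3) = fun t =>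
      deriv (deriv (deriv u)) t / Df t - 3 * (deriv (deriv u) t * D1f t) / Df t ^ 2 - 3 * (deriv u t * D2f t) / Df t ^ 2 +
        6 * (deriv u t * D1f t ^ 2) / Df t ^ 3 - u t * D3f t / Df t ^ 2 + 6 * (u t * (D1f t * D2f t)) / Df t ^ 3 -
        6 * (u t * D1f t ^ 3) / Df t ^ 4 := by
    funext t
    obtain ⟨h0, h1, h2, -⟩ := hasDerivAt_tower_of_contDiff_four hu t
    have hDt := hD0 t
    have hD1t := hD1 t
    have hpow2 : HasDerivAt (fun s : ℝ => Df s ^ 2) (2 * Df t * D1f t) t := by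
      have h := hDt.fun_mul hDt
      have hfun : (fun s : ℝ => Df s ^ 2) = fun s => Df s * Df s := funext fun s => sq _
      rw [hfun]; exact h.congr_deriv (by ring)
    have hpow3 : HasDerivAt (fun s : ℝ => Df s ^ 3) (3 * Df t ^ 2 * D1f t) t := by
      have h := (hDt.fun_mul hDt).fun_mul hDt
      have hfun : (fun s : ℝ => Df s ^ 3) = fun s => Df s * Df s * Df s := funext fun s => by ring
      rw [hfun]; exact h.congr_deriv (by ring)
    have hsq1 : HasDerivAt (fun s : ℝ => D1f s ^ 2) (2 * D1f t * D2f t) t := by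
      have h := hD1t.fun_mul hD1t
      have hfun : (fun s : ℝ => D1f s ^ 2) = fun s => D1f s * D1f s := funext fun s => sq _
      rw [hfun]; exact h.congr_deriv (by ring)
    have hA := h2.fun_div hDt (hDne t)
    have hB := (h0.fun_mul (hD2 t)).fun_div hpow2 (pow_ne_zero 2 (hDne t))
    have hC := ((h1.fun_mul hD1t).const_mul 2).fun_div hpow2 (pow_ne_zero 2 (hDne t))
    have hDD := ((h0.fun_mul hsq1).const_mul 2).fun_div hpow3 (pow_ne_zero 3 (hDne t))
    have hJ3 : HasDerivAt (fun t : ℝ =>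
        deriv (deriv u) t / Df t - u t * D2f t / Df t ^ 2 - 2 * (deriv u t * D1f t) / Df t ^ 2 +
        2 * (u t * D1f t ^ 2) / Df t ^ 3) _ t := ((hA.fun_sub hB).fun_sub hC).fun_add hDD
    rw [hJ3.deriv]
    have hD := hDne t
    field_simp
    ring
  -- fourth derivative at ϑ
  obtain ⟨h0, h1, h2, h3⟩ := hasDerivAt_tower_of_contDiff_four hu ϑ
  have hDϑ := hD0 ϑ
  have hD1ϑ := hD1 ϑ
  have hD2ϑ := hD2 ϑ
  have hpow2 : HasDerivAt (fun s : ℝ => Df s ^ 2) (2 * Df ϑ * D1f ϑ) ϑ := by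
    have h := hDϑ.fun_mul hDϑ
    have hfun : (fun s : ℝ => Df s ^ 2) = fun s => Df s * Df s := funext fun s => sq _
    rw [hfun]; exact h.congr_deriv (by ring)
  have hpow3 : HasDerivAt (fun s : ℝ => Df s ^ 3) (3 * Df ϑ ^ 2 * D1f ϑ) ϑ := by
    have h := (hDϑ.fun_mul hDϑ).fun_mul hDϑ
    have hfun : (fun s : ℝ => Df s ^ 3) = fun s => Df s * Df s * Df s := funext fun s => by ring
    rw [hfun]; exact h.congr_deriv (by ring)
  have hpow4 : HasDerivAt (fun s : ℝ => Df s ^ 4) (4 * Df ϑ ^ 3 * D1f ϑ) ϑ := by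
    have h := ((hDϑ.fun_mul hDϑ).fun_mul hDϑ).fun_mul hDϑ
    have hfun : (fun s : ℝ => Df s ^ 4) = fun s => Df s * Df s * Df s * Df s := funext fun s => by ring
    rw [hfun]; exact h.congr_deriv (by ring)
  have hsq1 : HasDerivAt (fun s : ℝ => D1f s ^ 2) (2 * D1f ϑ * D2f ϑ) ϑ := by
    have h := hD1ϑ.fun_mul hD1ϑ
    have hfun : (fun s : ℝ => D1f s ^ 2) = fun s => D1f s * D1f s := funext fun s => sq _
    rw [hfun]; exact h.congr_deriv (by ring)
  have hcube1 : HasDerivAt (fun s : ℝ => D1f s ^ 3) (3 * D1f ϑ ^ 2 * D2f ϑ) ϑ := by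
    have h := (hD1ϑ.fun_mul hD1ϑ).fun_mul hD1ϑ
    have hfun : (fun s : ℝ => D1f s ^ 3) = fun s => D1f s * D1f s * D1f s := funext fun s => by ring
    rw [hfun]; exact h.congr_deriv (by ring)
  have hT1 := h3.fun_div hDϑ (hDne ϑ)
  have hT2 := ((h2.fun_mul hD1ϑ).const_mul 3).fun_div hpow2 (pow_ne_zero 2 (hDne ϑ))
  have hT3 := ((h1.fun_mul hD2ϑ).const_mul 3).fun_div hpow2 (pow_ne_zero 2 (hDne ϑ))
  have hT4 := ((h1.fun_mul hsq1).const_mul 6).fun_div hpow3 (pow_ne_zero 3 (hDne ϑ))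
  have hT5 := (h0.fun_mul hD3).fun_div hpow2 (pow_ne_zero 2 (hDne ϑ))
  have hT6 := ((h0.fun_mul (hD1ϑ.fun_mul hD2ϑ)).const_mul 6).fun_div hpow3 (pow_ne_zero 3 (hDne ϑ))
  have hT7 := ((h0.fun_mul hcube1).const_mul 6).fun_div hpow4 (pow_ne_zero 4 (hDne ϑ))
  have hJ4 : HasDerivAt (fun t : ℝ =>
      deriv (deriv (deriv u)) t / Df t - 3 * (deriv (deriv u) t * D1f t) / Df t ^ 2 - 3 * (deriv u t * D2f t) / Df t ^ 2 +
        6 * (deriv u t * D1f t ^ 2) / Df t ^ 3 - u t * D3f t / Df t ^ 2 + 6 * (u t * (D1f t * D2f t)) / Df t ^ 3 -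
        6 * (u t * D1f t ^ 3) / Df t ^ 4) _ ϑ :=
    (((((hT1.fun_sub hT2).fun_sub hT3).fun_add hT4).fun_sub hT5).fun_add hT6).fun_sub hT7
  have hiter : deriv (deriv (deriv (deriv (fun t : ℝ => u t / Df t)))) ϑ = deriv (fun t =>
      deriv (deriv (deriv u)) t / Df t - 3 * (deriv (deriv u) t * D1f t) / Df t ^ 2 - 3 * (deriv u t * D2f t) / Df t ^ 2 +
        6 * (deriv u t * D1f t ^ 2) / Df t ^ 3 - u t * D3f t / Df t ^ 2 + 6 * (u t * (D1f t * D2f t)) / Df t ^ 3 -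
        6 * (u t * D1f t ^ 3) / Df t ^ 4) ϑ := by
    rw [j1, j2, j3]
  -- the twelve-term form
  have hΔ₃ : |D3f ϑ| ≤ E₄ * (R₁ + U₀) ^ 3 + 3 * (E₃ * (R₁ + U₀) * (R₂ + 2 * R₁ + U₀)) + 3 * (E₃ * (R₁ + U₀) ^ 2) + E₂ * (R₃ + 3 * R₂ + 3 * R₁ + U₀) + 3 * (E₂ * (R₂ + 2 * R₁ + U₀)) + 3 * (E₂ * (R₁ + U₀)) + E₁ :=
    abs_radialSlope_deriv_three_le (hE₁ ϑ) (hE₂ ϑ) (hE₃ ϑ) (hE₄ ϑ) (hU₀ ϑ) (hR₁ ϑ) (hR₂ ϑ) (hR₃ ϑ)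
  have hΔ₄ : |D₄| ≤ E₁ + 4 * E₂ * (R₁ + U₀) + 6 * E₂ * (R₂ + 2 * R₁ + U₀) + 4 * E₂ * (R₃ + 3 * R₂ + 3 * R₁ + U₀) + E₂ * (R₄ + 6 * R₂ + U₀ + (4 * R₃ + 4 * R₁)) + 6 * E₃ * (R₁ + U₀) * (R₁ + U₀) + 12 * E₃ * (R₁ + U₀) * (R₂ + 2 * R₁ + U₀) + 4 * E₃ * (R₁ + U₀) * (R₃ + 3 * R₂ + 3 * R₁ + U₀) + 3 * E₃ * (R₂ + 2 * R₁ + U₀) * (R₂ + 2 * R₁ + U₀) + 4 * E₄ * (R₁ + U₀) * (R₁ + U₀) * (R₁ + U₀) + 6 * E₄ * (R₁ + U₀) * (R₁ + U₀) * (R₂ + 2 * R₁ + U₀) + E₅ * (R₁ + U₀) * (R₁ + U₀) * (R₁ + U₀) * (R₁ + U₀) := by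
    rw [hD4def]
    exact abs_radialSlope_deriv_four_le he hu (hE₁ ϑ) (hE₂ ϑ) (hE₃ ϑ) (hE₄ ϑ) (hE₅ ϑ) (hU₀ ϑ) (hR₁ ϑ) (hR₂ ϑ) (hR₃ ϑ) (hR₄ ϑ)
  set D := Df ϑ with hDdef
  set D₁ := D1f ϑ
  set D₂ := D2f ϑ
  set D₃ := D3f ϑ
  set u0 := u ϑ; set u1 := deriv u ϑ; set u2 := deriv (deriv u) ϑ; set u3 := deriv (deriv (deriv u)) ϑ
  set u4 := deriv (deriv (deriv (deriv u))) ϑ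
  have hDge : ρ₀ ≤ D := hρ ϑ
  have hDpos : 0 < D := hρ0.trans_le hDge
  have hDabs : ρ₀ ≤ |D| := hDge.trans (le_abs_self _)
  have hval : deriv (fun t =>
      deriv (deriv (deriv u)) t / Df t - 3 * (deriv (deriv u) t * D1f t) / Df t ^ 2 - 3 * (deriv u t * D2f t) / Df t ^ 2 +
        6 * (deriv u t * D1f t ^ 2) / Df t ^ 3 - u t * D3f t / Df t ^ 2 + 6 * (u t * (D1f t * D2f t)) / Df t ^ 3 -
        6 * (u t * D1f t ^ 3) / Df t ^ 4) ϑ =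
      u4 / D - 4 * (u3 * D₁) / D ^ 2 - 6 * (u2 * D₂) / D ^ 2 + 12 * (u2 * D₁ ^ 2) / D ^ 3 - 4 * (u1 * D₃) / D ^ 2 + 24 * (u1 * (D₁ * D₂)) / D ^ 3 - 24 * (u1 * D₁ ^ 3) / D ^ 4 - u0 * D₄ / D ^ 2 + 8 * (u0 * (D₁ * D₃)) / D ^ 3 + 6 * (u0 * D₂ ^ 2) / D ^ 3 - 36 * (u0 * (D₁ ^ 2 * D₂)) / D ^ 4 + 24 * (u0 * D₁ ^ 4) / D ^ 5 := by
    rw [hJ4.deriv]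
    have hD := hDpos.ne'
    field_simp
    ring
  rw [hiter, hval]
  -- the sizes, and the algebraic lemma
  have hΔ₁ : |D₁| ≤ E₂ * (R₁ + U₀) + E₁ := abs_radialSlope_deriv_le (hE₁ ϑ) (hE₂ ϑ) (hU₀ ϑ) (hR₁ ϑ)
  have hΔ₂ : |D₂| ≤ E₃ * (R₁ + U₀) ^ 2 + E₂ * (R₂ + 2 * R₁ + U₀) + 2 * (E₂ * (R₁ + U₀)) + E₁ :=
    abs_radialSlope_deriv_two_le (hE₁ ϑ) (hE₂ ϑ) (hE₃ ϑ) (hU₀ ϑ) (hR₁ ϑ) (hR₂ ϑ)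
  exact abs_polarJac_four_terms_le hρ0 hDabs (hU₀ ϑ) (hR₁ ϑ) (hR₂ ϑ) (hR₃ ϑ) (hR₄ ϑ) hΔ₁ hΔ₂ hΔ₃ hΔ₄

end Polar

end Summit.HubbardSuperconductivity.HubbardSuperconductivity.Theorems.C4a
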